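/-
Copyright: the b2b-balaban T⁴-continuum CRUX team, row NE7b OWNER lineage `t4-ne7b-p1` (gen 139). Project licence.
-/
import Summits.QuantumFields.BalabanUV.T4Continuum.Spine.NE7b.SupOneSiteGibbsLetters
import Summits.QuantumFields.BalabanUV.T4Continuum.Spine.NE7b.SupExpFamilyLogDerivatives

/-!
# THE ONE-SITE GIBBS MEAN IS LIPSCHITZ IN THE POTENTIAL — Dobrushin's interdependence coefficient for log-concave one-site laws
# (SCOPING (d10)(2)): two `C¹` potentials `w₀, w₁` on `ℝ` with derivative floor `c > 0` and a ceiling, whose DIFFERENCE has derivative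
# bounded by `κ` (`|w₁′ − w₀′| ≤ κ`), have Gibbs means of any `L`-Lipschitz observable `h` within `Lκ∕c` of each other:
#   `|∫he^{−w₁}∕∫e^{−w₁} − ∫he^{−w₀}∕∫e^{−w₀}| ≤ Lκ∕c`
# (interpolate `w_t = w₀ + t(w₁ − w₀)`; by (330) `d∕dt E_t[h] = −Cov_t(h, w₁ − w₀)`; by (443) `|Cov_t(h,k)| ≤ Lκ·Var_t ≤ Lκ∕c`; mean value)
# — in Wasserstein terms `W₁(μ_{w₀}, μ_{w₁}) ≤ κ∕c`: the conditional law at a site moves by at most `sup|∂_z∂_xV|∕inf ∂_x²V` per unit change of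
# another coordinate, which is the entry `C_{xz}` of Dobrushin's matrix in (440)∕(442) (row NE7b, node U5c; (330), (443) BY NAME; [folklore])

Cell `pub-balaban`, sub-cell `t4`, spine estimate NE7b (`T4WeightBudget.RelWeightBound`; the cell's OWN estimate — NOT PRINTED in
[Bałaban 1983–89], NOT PROVED).  Crux-route work under `Spine/NE7b/` by the row OWNER (`t4-ne7b-p1` gen 139, file (444)) under FREEZE
(0)'s crux-prover clause; NOTHING of Bałaban's is named as a Lean object, valued or asserted; no `T4Continuum/Support` leaf typed; no
`def`, no notation; zero `sorry`.  Imports (BY NAME): the OWNER's (443) `…SupOneSiteGibbsLetters` (`integrable_exp_neg_mul_exp_abs`,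
`integral_exp_neg_pos`, `cov_raw_abs_le_floor`, `lip_continuous`, `w_continuous`), (330) `…SupExpFamilyLogDerivatives`
(`hasDerivAt_fs_t`); Mathlib's `Convex.norm_image_sub_le_of_norm_hasDerivWithin_le`, `norm_image_sub_le_of_norm_deriv_le_segment'`.

WHAT IS PROVED ([folklore]; `w₀ w₁ w₀′ w₁′ h : ℝ → ℝ`):
* §1 the interpolation `w_t = w₀ + t(w₁ − w₀)`, `t ∈ [0,1]`: `interp_hasDerivAt`, `interp_floor`, `interp_ceiling` (it inherits the floor
  `c` and the ceiling `Cw`), `diff_lipschitz` (`|k s − k u| ≤ κ|s − u|` for `k = w₁ − w₀`), `family_rewrite` (the exponential family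
  `e^{−w₀}·X·e^{0·h + t(w₀−w₁)}` of (330) is `X·e^{−w_t}`), `family_letter` (its `4`-letter), `family_pos`.
* §2 THE END **`gibbs_mean_lipschitz`** (`|∫he^{−w₁}∕∫e^{−w₁} − ∫he^{−w₀}∕∫e^{−w₀}| ≤ Lκ∕c`).
* §3 toy: none beyond (443)'s (the statement is an inequality between two genuine integrals).

HONEST (what this is NOT).  One-dimensional; the sampler on `ℝ^ι` built on it, its invariance and the covariance estimate are
(445)–(446); the road instance (447).  Scalar skeleton ((A3), NC-NE7b-α UNRULED); nothing of Bałaban's asserted.  BY-NAME EFFECT ON THE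
WALL: NONE.  NE7b NOT PRINTED ∕ NOT PROVED; spine PROVED 0∕9; rung (B)+1 — the programme's measures remain FINITE-torus statements; NOT
the mass gap, NOT Clay.  HONEST DEPENDENCY: continuum YM on T⁴ ⇐ BetaPertH ∧ nine spine estimates (0∕9 proved); BetaPertH ⇐ (D1) ∧ (D4) ∧
CAP+tail; G-an2-4 gates asym, D1 and NE2∕3∕4.
-/

set_option autoImplicit false

noncomputable section

namespace Summit.QuantumFields.BalabanUV.T4Continuum.NE7b.SupOneSiteGibbsLipschitz

open MeasureTheory Real Set
open SupOneSiteGibbsLetters (integrable_exp_neg_mul_exp_abs integral_exp_neg_pos cov_raw_abs_le_floor lip_continuous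
  w_continuous)
open SupExpFamilyLogDerivatives (hasDerivAt_fs_t)

variable {w₀ w₁ w₀' w₁' : ℝ → ℝ} {c Cw κ : ℝ}

/-! ## §1. The interpolation and the exponential family -/

/-- `w_t = w₀ + t(w₁ − w₀)` is `C¹` with derivative `w₀′ + t(w₁′ − w₀′)`. [folklore] -/
theorem interp_hasDerivAt (hw₀ : ∀ s, HasDerivAt w₀ (w₀' s) s) (hw₁ : ∀ s, HasDerivAt w₁ (w₁' s) s) (t s : ℝ) :
    HasDerivAt (fun s => w₀ s + t * (w₁ s - w₀ s)) (w₀' s + t * (w₁' s - w₀' s)) s :=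
  (hw₀ s).fun_add (((hw₁ s).fun_sub (hw₀ s)).const_mul t)

/-- `w_t` inherits the floor `c` for `t ∈ [0,1]`. [folklore] -/
theorem interp_floor (hmono₀ : ∀ s u, c * (s - u) ^ 2 ≤ (w₀' s - w₀' u) * (s - u))
    (hmono₁ : ∀ s u, c * (s - u) ^ 2 ≤ (w₁' s - w₁' u) * (s - u)) {t : ℝ} (ht0 : 0 ≤ t) (ht1 : t ≤ 1) (s u : ℝ) :
    c * (s - u) ^ 2 ≤ ((w₀' s + t * (w₁' s - w₀' s)) - (w₀' u + t * (w₁' u - w₀' u))) * (s - u) := by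
  have h0 := hmono₀ s u
  have h1 := hmono₁ s u
  have e : ((w₀' s + t * (w₁' s - w₀' s)) - (w₀' u + t * (w₁' u - w₀' u))) * (s - u) =
      (1 - t) * ((w₀' s - w₀' u) * (s - u)) + t * ((w₁' s - w₁' u) * (s - u)) := by ring
  rw [e]
  nlinarith

/-- `w_t` inherits the ceiling `Cw` for `t ∈ [0,1]`. [folklore] -/
theorem interp_ceiling (hlip₀ : ∀ s u, |w₀' s - w₀' u| ≤ Cw * |s - u|) (hlip₁ : ∀ s u, |w₁' s - w₁' u| ≤ Cw * |s - u|) {t : ℝ}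
    (ht0 : 0 ≤ t) (ht1 : t ≤ 1) (s u : ℝ) :
    |(w₀' s + t * (w₁' s - w₀' s)) - (w₀' u + t * (w₁' u - w₀' u))| ≤ Cw * |s - u| := by
  have h0 := hlip₀ s u
  have h1 := hlip₁ s u
  have e : (w₀' s + t * (w₁' s - w₀' s)) - (w₀' u + t * (w₁' u - w₀' u)) = (1 - t) * (w₀' s - w₀' u) + t * (w₁' s - w₁' u) := by ring
  rw [e]
  calc |(1 - t) * (w₀' s - w₀' u) + t * (w₁' s - w₁' u)| ≤ |(1 - t) * (w₀' s - w₀' u)| + |t * (w₁' s - w₁' u)| := abs_add_le _ _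
    _ = (1 - t) * |w₀' s - w₀' u| + t * |w₁' s - w₁' u| := by
        rw [abs_mul, abs_mul, abs_of_nonneg (by linarith : 0 ≤ 1 - t), abs_of_nonneg ht0]
    _ ≤ (1 - t) * (Cw * |s - u|) + t * (Cw * |s - u|) :=
        add_le_add (mul_le_mul_of_nonneg_left h0 (by linarith)) (mul_le_mul_of_nonneg_left h1 ht0)
    _ = Cw * |s - u| := by ring

/-- The difference `k = w₁ − w₀` is `κ`-Lipschitz when `|w₁′ − w₀′| ≤ κ` (mean value theorem). [folklore] -/
theorem diff_lipschitz (hw₀ : ∀ s, HasDerivAt w₀ (w₀' s) s) (hw₁ : ∀ s, HasDerivAt w₁ (w₁' s) s) (hk : ∀ s, |w₁' s - w₀' s| ≤ κ)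
    (s u : ℝ) : |(w₀ s - w₁ s) - (w₀ u - w₁ u)| ≤ κ * |s - u| := by
  have hd : ∀ x ∈ (univ : Set ℝ), HasDerivWithinAt (fun s => w₀ s - w₁ s) (w₀' x - w₁' x) univ x :=
    fun x _ => ((hw₀ x).fun_sub (hw₁ x)).hasDerivWithinAt
  have hb : ∀ x ∈ (univ : Set ℝ), ‖w₀' x - w₁' x‖ ≤ κ := fun x _ => by
    rw [Real.norm_eq_abs, abs_sub_comm]; exact hk x
  have h := convex_univ.norm_image_sub_le_of_norm_hasDerivWithin_le hd hb (mem_univ u) (mem_univ s)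
  rwa [Real.norm_eq_abs, Real.norm_eq_abs] at h

/-- **The exponential family of (330) is the interpolated Gibbs weight**: `e^{−w₀ s}·X·e^{0·h s + t(w₀ s − w₁ s)} = X·e^{−w_t s}`. [folklore] -/
theorem family_rewrite (h : ℝ → ℝ) (X t s : ℝ) :
    exp (-w₀ s) * X * exp (0 * h s + t * (w₀ s - w₁ s)) = X * exp (-(w₀ s + t * (w₁ s - w₀ s))) := by
  have e : -w₀ s + (0 * h s + t * (w₀ s - w₁ s)) = -(w₀ s + t * (w₁ s - w₀ s)) := by ring
  calc exp (-w₀ s) * X * exp (0 * h s + t * (w₀ s - w₁ s)) = X * (exp (-w₀ s) * exp (0 * h s + t * (w₀ s - w₁ s))) := by ring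
    _ = X * exp (-(w₀ s + t * (w₁ s - w₀ s))) := by rw [← exp_add, e]

/-- **The `4`-letter of the family**: `e^{−w₀}·e^{4(|h| + |w₀ − w₁|)}` is integrable (`h` `L`-Lipschitz, `w₀ − w₁` `κ`-Lipschitz, floor `c`).
[folklore] -/
theorem family_letter (hw₀ : ∀ s, HasDerivAt w₀ (w₀' s) s) (hw₁ : ∀ s, HasDerivAt w₁ (w₁' s) s)
    (hmono₀ : ∀ s u, c * (s - u) ^ 2 ≤ (w₀' s - w₀' u) * (s - u)) (hc : 0 < c) (hk : ∀ s, |w₁' s - w₀' s| ≤ κ) {h : ℝ → ℝ} {L : ℝ}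
    (hh : ∀ s u, |h s - h u| ≤ L * |s - u|) :
    Integrable (fun s => |exp (-w₀ s)| * exp (4 * (|h s| + |w₀ s - w₁ s|))) := by
  have hkL := diff_lipschitz hw₀ hw₁ hk
  have hhc := lip_continuous hh
  have hkc : Continuous fun s => w₀ s - w₁ s := (w_continuous hw₀).sub (w_continuous hw₁)
  set M : ℝ := |h 0| + L + (|w₀ 0 - w₁ 0| + κ) with hM
  refine ((integrable_exp_neg_mul_exp_abs hw₀ hmono₀ hc (4 * M)).const_mul (exp (4 * M))).mono'
    (((continuous_exp.comp (w_continuous hw₀).neg).abs.mul (continuous_exp.comp (((hhc.abs).add hkc.abs).const_mul 4)))).aestronglyMeasurable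
    (ae_of_all _ fun s => ?_)
  rw [Real.norm_of_nonneg (mul_nonneg (abs_nonneg _) (exp_pos _).le), abs_of_pos (exp_pos _)]
  -- `|h s| + |k s| ≤ M(1 + |s|)`
  have hlin : |h s| + |w₀ s - w₁ s| ≤ M * (1 + |s|) := by
    have h1 : |h s| ≤ |h 0| + L * |s| := by
      have := hh s 0; rw [sub_zero] at this; have := abs_sub_abs_le_abs_sub (h s) (h 0); linarith
    have h2 : |w₀ s - w₁ s| ≤ |w₀ 0 - w₁ 0| + κ * |s| := by
      have := hkL s 0; rw [sub_zero] at this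
      have := abs_sub_abs_le_abs_sub (w₀ s - w₁ s) (w₀ 0 - w₁ 0); linarith
    have hL : 0 ≤ L := by
      have := hh 1 0; rw [sub_zero, abs_one, mul_one] at this; exact (abs_nonneg _).trans this
    have hκ : 0 ≤ κ := (abs_nonneg _).trans (hk 0)
    rw [hM]
    nlinarith [abs_nonneg s, abs_nonneg (h 0), abs_nonneg (w₀ 0 - w₁ 0)]
  calc exp (-w₀ s) * exp (4 * (|h s| + |w₀ s - w₁ s|)) ≤ exp (-w₀ s) * exp (4 * (M * (1 + |s|))) :=
        mul_le_mul_of_nonneg_left (exp_le_exp.2 (by linarith)) (exp_pos _).le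
    _ = exp (4 * M) * (exp (-w₀ s) * exp (4 * M * |s|)) := by
        have e : 4 * (M * (1 + |s|)) = 4 * M + 4 * M * |s| := by ring
        rw [e, exp_add]; ring

/-- **The family's normalisation is positive on the square** `|a|, |t| ≤ 1`: `0 < ∫e^{−w₀}e^{a·h + t(w₀−w₁)}`. [folklore] -/
theorem family_pos (hw₀ : ∀ s, HasDerivAt w₀ (w₀' s) s) (hw₁ : ∀ s, HasDerivAt w₁ (w₁' s) s)
    (hmono₀ : ∀ s u, c * (s - u) ^ 2 ≤ (w₀' s - w₀' u) * (s - u)) (hc : 0 < c) (hk : ∀ s, |w₁' s - w₀' s| ≤ κ) {h : ℝ → ℝ} {L : ℝ}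
    (hh : ∀ s u, |h s - h u| ≤ L * |s - u|) (a t : ℝ) (ha : |a| ≤ 1) (ht : |t| ≤ 1) :
    0 < ∫ s, exp (-w₀ s) * exp (a * h s + t * (w₀ s - w₁ s)) := by
  have hlet := family_letter hw₀ hw₁ hmono₀ hc hk hh
  have hhc := lip_continuous hh
  have hkc : Continuous fun s => w₀ s - w₁ s := (w_continuous hw₀).sub (w_continuous hw₁)
  have e : (fun s => exp (-w₀ s) * exp (a * h s + t * (w₀ s - w₁ s))) = fun s => exp (-w₀ s + (a * h s + t * (w₀ s - w₁ s))) := by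
    funext s; exact (exp_add _ _).symm
  rw [e]
  refine integral_exp_pos (hlet.mono' (continuous_exp.comp ((w_continuous hw₀).neg.add
    ((continuous_const.mul hhc).add (continuous_const.mul hkc)))).aestronglyMeasurable (ae_of_all _ fun s => ?_))
  rw [Real.norm_of_nonneg (exp_pos _).le, abs_of_pos (exp_pos _), exp_add]
  refine mul_le_mul_of_nonneg_left (exp_le_exp.2 ?_) (exp_pos _).le
  have h1 : a * h s ≤ |h s| := by
    have := abs_mul a (h s); have := le_abs_self (a * h s)
    nlinarith [abs_nonneg (h s), abs_nonneg a]
  have h2 : t * (w₀ s - w₁ s) ≤ |w₀ s - w₁ s| := by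
    have := abs_mul t (w₀ s - w₁ s); have := le_abs_self (t * (w₀ s - w₁ s))
    nlinarith [abs_nonneg (w₀ s - w₁ s), abs_nonneg t]
  nlinarith [abs_nonneg (h s), abs_nonneg (w₀ s - w₁ s)]

/-! ## §2. The Gibbs mean is Lipschitz in the potential -/

/-- **DOBRUSHIN'S COEFFICIENT FOR A LOG-CONCAVE ONE-SITE LAW**: `C¹` potentials `w₀, w₁` with derivative floor `c > 0`, a ceiling `Cw`,
and `|w₁′ − w₀′| ≤ κ`; `h` `L`-Lipschitz ⟹ `|∫he^{−w₁}∕∫e^{−w₁} − ∫he^{−w₀}∕∫e^{−w₀}| ≤ Lκ∕c`. [folklore] -/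
theorem gibbs_mean_lipschitz (hw₀ : ∀ s, HasDerivAt w₀ (w₀' s) s) (hw₁ : ∀ s, HasDerivAt w₁ (w₁' s) s)
    (hmono₀ : ∀ s u, c * (s - u) ^ 2 ≤ (w₀' s - w₀' u) * (s - u)) (hmono₁ : ∀ s u, c * (s - u) ^ 2 ≤ (w₁' s - w₁' u) * (s - u))
    (hc : 0 < c) (hlip₀ : ∀ s u, |w₀' s - w₀' u| ≤ Cw * |s - u|) (hlip₁ : ∀ s u, |w₁' s - w₁' u| ≤ Cw * |s - u|)
    (hk : ∀ s, |w₁' s - w₀' s| ≤ κ) {h : ℝ → ℝ} {L : ℝ} (hh : ∀ s u, |h s - h u| ≤ L * |s - u|) :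
    |(∫ s, h s * exp (-w₁ s)) / (∫ s, exp (-w₁ s)) - (∫ s, h s * exp (-w₀ s)) / (∫ s, exp (-w₀ s))| ≤ L * κ / c := by
  have hL : 0 ≤ L := by
    have := hh 1 0; rw [sub_zero, abs_one, mul_one] at this; exact (abs_nonneg _).trans this
  have hκ : 0 ≤ κ := (abs_nonneg _).trans (hk 0)
  have hkL := diff_lipschitz hw₀ hw₁ hk
  have hhc := lip_continuous hh
  have hΦm : Measurable fun s => exp (-w₀ s) := (continuous_exp.comp (w_continuous hw₀).neg).measurable
  have hBm : Measurable fun s => w₀ s - w₁ s := ((w_continuous hw₀).sub (w_continuous hw₁)).measurable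
  have hlet := family_letter hw₀ hw₁ hmono₀ hc hk hh
  have hpos : ∀ a t : ℝ, |a| ≤ 1 → |t| ≤ 1 → 0 < ∫ s, exp (-w₀ s) * exp (a * h s + t * (w₀ s - w₁ s)) :=
    fun a t ha ht => family_pos hw₀ hw₁ hmono₀ hc hk hh a t ha ht
  -- the mean along the family and its derivative (330)
  have hder : ∀ t ∈ Icc (0 : ℝ) 1, HasDerivWithinAt
      (fun t => (∫ s, exp (-w₀ s) * h s * exp (0 * h s + t * (w₀ s - w₁ s))) / (∫ s, exp (-w₀ s) * exp (0 * h s + t * (w₀ s - w₁ s))))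
      (((∫ s, exp (-w₀ s) * h s * (w₀ s - w₁ s) * exp (0 * h s + t * (w₀ s - w₁ s))) *
          (∫ s, exp (-w₀ s) * exp (0 * h s + t * (w₀ s - w₁ s))) -
        (∫ s, exp (-w₀ s) * h s * exp (0 * h s + t * (w₀ s - w₁ s))) *
          (∫ s, exp (-w₀ s) * (w₀ s - w₁ s) * exp (0 * h s + t * (w₀ s - w₁ s)))) /
        (∫ s, exp (-w₀ s) * exp (0 * h s + t * (w₀ s - w₁ s))) ^ 2) (Icc 0 1) t := by
    intro t ht
    have ht' : |t| ≤ 1 := abs_le.2 ⟨by linarith [ht.1], ht.2⟩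
    exact (hasDerivAt_fs_t (μ := volume) hΦm hhc.measurable hBm hlet hpos (s := 0) (by simp) ht').hasDerivWithinAt
  -- the derivative is a covariance of the interpolated law, bounded by `Lκ/c`
  have hbound : ∀ t ∈ Ico (0 : ℝ) 1,
      ‖((∫ s, exp (-w₀ s) * h s * (w₀ s - w₁ s) * exp (0 * h s + t * (w₀ s - w₁ s))) *
          (∫ s, exp (-w₀ s) * exp (0 * h s + t * (w₀ s - w₁ s))) -
        (∫ s, exp (-w₀ s) * h s * exp (0 * h s + t * (w₀ s - w₁ s))) *
          (∫ s, exp (-w₀ s) * (w₀ s - w₁ s) * exp (0 * h s + t * (w₀ s - w₁ s)))) /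
        (∫ s, exp (-w₀ s) * exp (0 * h s + t * (w₀ s - w₁ s))) ^ 2‖ ≤ L * κ / c := by
    intro t ht
    have ht0 : 0 ≤ t := ht.1
    have ht1 : t ≤ 1 := ht.2.le
    -- rewrite the four integrands as `X·e^{−w_t}`
    have e1 : (fun s => exp (-w₀ s) * h s * (w₀ s - w₁ s) * exp (0 * h s + t * (w₀ s - w₁ s))) =
        fun s => h s * (w₀ s - w₁ s) * exp (-(w₀ s + t * (w₁ s - w₀ s))) := by
      funext s; rw [← family_rewrite h (h s * (w₀ s - w₁ s)) t s]; ring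
    have e2 : (fun s => exp (-w₀ s) * exp (0 * h s + t * (w₀ s - w₁ s))) = fun s => exp (-(w₀ s + t * (w₁ s - w₀ s))) := by
      funext s; rw [← one_mul (exp (-(w₀ s + t * (w₁ s - w₀ s)))), ← family_rewrite h 1 t s]; ring
    have e3 : (fun s => exp (-w₀ s) * h s * exp (0 * h s + t * (w₀ s - w₁ s))) = fun s => h s * exp (-(w₀ s + t * (w₁ s - w₀ s))) := by
      funext s; rw [← family_rewrite h (h s) t s]
    have e4 : (fun s => exp (-w₀ s) * (w₀ s - w₁ s) * exp (0 * h s + t * (w₀ s - w₁ s))) =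
        fun s => (w₀ s - w₁ s) * exp (-(w₀ s + t * (w₁ s - w₀ s))) := by
      funext s; rw [← family_rewrite h (w₀ s - w₁ s) t s]
    rw [e1, e2, e3, e4]
    -- the interpolated law's letters
    have hwt := interp_hasDerivAt hw₀ hw₁ t
    have hmt := interp_floor hmono₀ hmono₁ ht0 ht1
    have hct := interp_ceiling hlip₀ hlip₁ ht0 ht1
    have hZt := integral_exp_neg_pos hwt hmt hc
    have hcov := cov_raw_abs_le_floor hwt hmt hc hct hh hkL
    rw [Real.norm_eq_abs, abs_div, abs_of_pos (pow_pos hZt 2), div_le_iff₀ (pow_pos hZt 2)]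
    calc |(∫ s, h s * (w₀ s - w₁ s) * exp (-(w₀ s + t * (w₁ s - w₀ s)))) * (∫ s, exp (-(w₀ s + t * (w₁ s - w₀ s)))) -
          (∫ s, h s * exp (-(w₀ s + t * (w₁ s - w₀ s)))) * (∫ s, (w₀ s - w₁ s) * exp (-(w₀ s + t * (w₁ s - w₀ s))))|
        ≤ L * κ * ((∫ s, exp (-(w₀ s + t * (w₁ s - w₀ s)))) ^ 2 / c) := hcov
      _ = L * κ / c * (∫ s, exp (-(w₀ s + t * (w₁ s - w₀ s)))) ^ 2 := by ring
  -- mean value along `[0,1]`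
  have hMV := norm_image_sub_le_of_norm_deriv_le_segment' hder hbound 1 (right_mem_Icc.2 zero_le_one)
  rw [sub_zero, mul_one, Real.norm_eq_abs] at hMV
  -- identify the endpoints
  have e1 : (fun s => exp (-w₀ s) * h s * exp (0 * h s + (1 : ℝ) * (w₀ s - w₁ s))) = fun s => h s * exp (-w₁ s) := by
    funext s
    rw [show exp (-w₀ s) * h s * exp (0 * h s + (1 : ℝ) * (w₀ s - w₁ s)) = h s * (exp (-w₀ s) * exp (0 * h s + (1 : ℝ) * (w₀ s - w₁ s)))
      by ring, ← exp_add, show -w₀ s + (0 * h s + (1 : ℝ) * (w₀ s - w₁ s)) = -w₁ s by ring]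
  have e2 : (fun s => exp (-w₀ s) * exp (0 * h s + (1 : ℝ) * (w₀ s - w₁ s))) = fun s => exp (-w₁ s) := by
    funext s
    rw [← exp_add, show -w₀ s + (0 * h s + (1 : ℝ) * (w₀ s - w₁ s)) = -w₁ s by ring]
  have e3 : (fun s => exp (-w₀ s) * h s * exp (0 * h s + (0 : ℝ) * (w₀ s - w₁ s))) = fun s => h s * exp (-w₀ s) := by
    funext s
    rw [show (0 : ℝ) * h s + 0 * (w₀ s - w₁ s) = 0 by ring, exp_zero, mul_one, mul_comm]
  have e4 : (fun s => exp (-w₀ s) * exp (0 * h s + (0 : ℝ) * (w₀ s - w₁ s))) = fun s => exp (-w₀ s) := by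
    funext s
    rw [show (0 : ℝ) * h s + 0 * (w₀ s - w₁ s) = 0 by ring, exp_zero, mul_one]
  simp only [e1, e2, e3, e4] at hMV
  exact hMV

end Summit.QuantumFields.BalabanUV.T4Continuum.NE7b.SupOneSiteGibbsLipschitz

end
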